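import Summits.QuantumFields.BalabanUV.T4Continuum.Spine.NE1p.DressedSuppliedAbsorptionWitness
import Summits.QuantumFields.BalabanUV.T4Continuum.Spine.NE1p.DressedTowerWitnessBlocks

/-!
# T⁴ programme, spine estimate NE1′ (node O3b/H2) — THE ABSORBED COUNT GROWS, PART 1: a decided (γ)-datum on which S5e's absorbed
# count `(vR·mB)·Λ^(j_b−j₀)` and S3i's live count `N₀·Λ^(k−j)` are ATTAINED — sixteen block families one scale down absorbed by ONE
# family (non-trivial coarsening), then W37's chain (crew row W⟨next⟩; INTENT HOME/CLAIMS.log 2026-08-20; the typer labels ∕ books)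

Cell `pub-balaban`, sub-cell `t4`, BINDER-OWNERS row NE1′, crew `b2b-balaban-t4-ne1p-formalise-*`, seat `leaf-02` (gen 13; lineage S3i ∕
S5e ∕ W8 ∕ W32 ∕ W37).  ADDITIVE — imports W37 PART 1 `Spine/NE1p/DressedSuppliedAbsorptionWitness` (p227787; → W32 → row S3u, W20's
push `vmap`) and W14 PART 1 `Spine/NE1p/DressedTowerWitnessBlocks` (p216469: the block arithmetic `Blk` ∕ `coords` ∕ `coords_injective` ∕
`coarsen_coords_succ` BY NAME — nothing of W14's datum) ONLY; toy DATA `def`s + theorems; nothing of S3u ∕ S3i ∕ S5e ∕ S5b ∕ W14 ∕ W18 ∕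
W20 ∕ W32 ∕ W37 is restated.  PART 2 (`…WitnessEnd`) applies row S3u §2's supplied ENDs and proves the GENUINENESS records.

WHY.  Row S5e's `hbirth_of_rstep_anchored` feeds `hbirth_of_rstep` the absorbed COUNT `count_absorbs_of_anchoring`
(`card (absorbs b ∩ scale j₀) ≤ (v·mB)·((Lb:ℝ)^d)^(j_b − j₀)`), and S3u §2 derives the live COUNT `hcount ≤ N₀·Λ^(k−j)` from the anchoring
(S3i `count_of_anchoring_cell`).  On the (γ) END OF RECORD both were met with the Λ-factor IDLE: W32 `absorbs := ∅`, W37 `absorbs b =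
{b−1}` (card `≤ 1 = vR·mB`), one family per birth scale per component (counts `≤ 1`); the Λ-growth was exercised only on the (α′)
terminal face (W14).  THIS PART decides a datum on which BOTH counts reach `Λ = 2⁴` with EQUALITY while the window stays W37's:
* §1 `towerQ` [decided toy]: at cutoff `K`, births `Blk 2 ⊕ Fin K` — SIXTEEN block families born at scale `0`, one per block
  `x ∈ {0,1}⁴ ⊂ ℕ⁴` (anchored at `coords x`), and the chain `i ↦` born at scale `i+1`, anchored at the origin block; cubes `Blk 2 ⊕ Fin K`
  (scale-`0` blocks feeling their own family; ONE origin cube per scale `k ≥ 1` feeling everything born `≤ k` — `felt_under` by the GENUINE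
  coarsening `coarsen 2 k (coords x) = 0`); coefficients BY THE LAW: blocks `12·c₀Q K = ½·(⅛)^K`, **chain head
  `12·cQ K 0 = ½·(⅛)^(K−1) + ⅛·(16·3·c₀Q K)`** (the sixteen absorbed pre-ℝ masses), `12·cQ K (i+1) = ½·(⅛)^(K−(i+2)) + ⅜·cQ K i` (W37's
  chain); ℝ-step `RsQ K`: **`absorbs (inr 0) = the sixteen block families`**, `absorbs (inr (i+1)) = {inr i}`, `absorbs (inl x) = ∅`; `comp` =
  the birth cube; `pre := ψ·envVar(·, k−1)` (equality seam); `δ = βR` (W37's dressing `½·(⅛)^(K−j)` BY NAME); live sets: step `0` = the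
  family alone in its block, steps `1 ≤ k ≤ K` = everything born `≤ k`, `∅` above `K`.
* §2 S3u §2's function-level binders (W37 §2's proofs re-run on the new index type: `hG_Q`, `hinv_Q`, `hVK_Q`∕`hVrel_Q`, `hneX_Q`∕
  `hsupX_Q`, `hreg_Q` — (w5) idle as W18∕W37).  PART 2 carries the supplier data (multiplicity by W14's `coords_injective`, housing at
  both layers, the ℝ-step's law WITH EQUALITY at all three kinds of birth — the chain head's absorbed mass `16·(3·c₀Q K)` by
  `Fintype.card (Fin 4 → Fin 2) = 2⁴`), the END and the GENUINENESS records.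
Planted mutants (NOT filed; rc 1 each): `cQ K 0` without the block term (`cQ_zero`), `absorbsQ (inr 0) := {inl 0}` (PART 2's
`absorbed_sum_blocks`), live sets uncapped (PART 2's `hhoused_Q`).

HONEST FRAMING (c4; offered wording).  «Row S3u §2's supplied ENDs fire on a decided (γ)-datum on which S5e's absorbed count and S3i's
live count ATTAIN their positional bounds `(vR·mB)·Λ^(j_b−j₀)` ∕ `N₀·Λ^(k−j)` (sixteen block families absorbed by one family one scale
up, non-trivial coarsening) at W37's window (`A·N = ⅛`, amplitude ⅔) — the Λ-factor LOAD-BEARING on the END OF RECORD; `Anchoring`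
(row S3i) ∕ `RStep` (row O3.E-iii-c) are the crew's SHAPES, the seams equalities BY DEFINITION, the block arithmetic W14's BY NAME;
SOCKET COMPOSITION certified, NOT that components ∕ ℝ-operations of [Balaban1989LargeFieldII] were constructed or bounded; S3v's
supplied ENDs untouched; discharges no wall item; the wall line (v1.7 = WORDS NOT KIND) does NOT move; R-t4r2-Q2 NOT met thereby; NE1′
NOT proved.»  [decided toy] ∕ [folklore]; 0 `def … : Prop`; 0 citations (the bracketed paper name is the rider's wording, no locus
used).  NE1′ NOT printed, NOT proved; spine PROVED 0∕9; count 9 unchanged.  Rung (B)+1 on ONE finite four-torus — NOT infinite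
volume, NOT a mass gap, NOT OS on ℝ⁴, NOT Clay.  HONEST DEPENDENCY: continuum YM on T⁴ ⇐ BetaPertH ∧ nine spine estimates (0/9
proved); BetaPertH ⇐ (D1) ∧ (D4) ∧ CAP+tail; G-an2-4 gates asym, D1 and NE2/3/4.
-/

noncomputable section

namespace Summit.QuantumFields.BalabanUV.T4Continuum.NE1p.DressedSuppliedBlockAbsorptionWitness

open Set Metric Finset
open scoped BigOperators
open Literature.MathematicalPhysics.QuantumFieldTheory.Balaban1983to89
open Literature.MathematicalPhysics.QuantumFieldTheory.Balaban1983to89.T4TermFormat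
open Literature.MathematicalPhysics.QuantumFieldTheory.Balaban1983to89.T4FeltGeometry
open Literature.MathematicalPhysics.QuantumFieldTheory.Balaban1983to89.T4TrajectoryComparison
open Literature.MathematicalPhysics.QuantumFieldTheory.Balaban1983to89.T4BirthChartTransport (GaugeInvariant BirthSlice RelGauge)
open Literature.MathematicalPhysics.QuantumFieldTheory.Balaban1983to89.T4PreservedUnderR (RStep)
open Summit.QuantumFields.BalabanUV.T4Continuum.T4TrajectoryDensityDressed
open Summit.QuantumFields.BalabanUV.T4Continuum.NE1p.DressedRoot (DressedTower)
open Summit.QuantumFields.BalabanUV.T4Continuum.NE1p.DressedValueMapWitness (vmap norm_vmap vmap_affine theta_pow_le_one)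
open Summit.QuantumFields.BalabanUV.T4Continuum.NE1p.DressedSuppliedAbsorptionWitness (cR cR_pos βR)
open Summit.QuantumFields.BalabanUV.T4Continuum.NE1p.DressedTowerWitnessBlocks (Blk coords coords_injective coarsen_coords_zero coarsen_coords_succ)

/-! ## §1 The datum: sixteen block families one scale down, absorbed by the head of W37's chain -/

/-- COEFFICIENT of every block family (born at scale `0`) [decided toy]: `12·c₀Q K = ½·(⅛)^K` — half the class, nobody to absorb. [folklore] -/
def c₀Q (K : ℕ) : ℝ := (1 / 2 : ℝ) * (1 / 8 : ℝ) ^ K / 12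

/-- COEFFICIENTS of the chain (family `i` born at scale `i+1`) BY THE ABSORPTION LAW [decided toy]: the head absorbs the SIXTEEN blocks
(`12·cQ K 0 = ½·(⅛)^(K−1) + ⅛·(16·3·c₀Q K)`), every later member the previous one (W37's recursion). [folklore] -/
def cQ (K : ℕ) : ℕ → ℝ
  | 0 => ((1 / 2 : ℝ) * (1 / 8 : ℝ) ^ (K - 1) + (1 / 8 : ℝ) * (16 * (3 * c₀Q K))) / 12
  | i + 1 => ((1 / 2 : ℝ) * (1 / 8 : ℝ) ^ (K - (i + 2)) + (3 / 8 : ℝ) * cQ K i) / 12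

/-- [folklore] The block law in coefficients. -/
theorem c₀Q_law (K : ℕ) : 12 * c₀Q K = (1 / 2 : ℝ) * (1 / 8 : ℝ) ^ K := by unfold c₀Q; ring

/-- [folklore] The chain head's law: dressing + one eighth of SIXTEEN absorbed block masses. -/
theorem cQ_zero (K : ℕ) : 12 * cQ K 0 = (1 / 2 : ℝ) * (1 / 8 : ℝ) ^ (K - 1) + (1 / 8 : ℝ) * (16 * (3 * c₀Q K)) := by
  simp only [cQ]; ring

/-- [folklore] The chain's step (W37's recursion). -/
theorem cQ_succ (K i : ℕ) : 12 * cQ K (i + 1) = (1 / 2 : ℝ) * (1 / 8 : ℝ) ^ (K - (i + 2)) + (3 / 8 : ℝ) * cQ K i := by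
  simp only [cQ]; ring

/-- [folklore] Positivity. -/
theorem c₀Q_pos (K : ℕ) : 0 < c₀Q K := by unfold c₀Q; positivity

/-- [folklore] Positivity. -/
theorem cQ_pos (K : ℕ) : ∀ i, 0 < cQ K i
  | 0 => by have := c₀Q_pos K; simp only [cQ]; positivity
  | i + 1 => by have := cQ_pos K i; simp only [cQ]; positivity

/-- SCALE of an index [decided toy]: blocks at `0`, chain member `i` at `i+1` (births AND cubes share the index type). [folklore] -/
def scaleQ (K : ℕ) : Blk 2 ⊕ Fin K → ℕ
  | Sum.inl _ => 0
  | Sum.inr i => i.val + 1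

/-- CARRIED COEFFICIENT of a family [decided toy]. [folklore] -/
def coefQ (K : ℕ) : Blk 2 ⊕ Fin K → ℝ
  | Sum.inl _ => c₀Q K
  | Sum.inr i => cQ K i.val

/-- [folklore] Scales are `≤ K`. -/
theorem scaleQ_le (K : ℕ) : ∀ b, scaleQ K b ≤ K
  | Sum.inl _ => Nat.zero_le K
  | Sum.inr i => i.isLt

/-- [folklore] Coefficients are positive. -/
theorem coefQ_pos (K : ℕ) : ∀ b, 0 < coefQ K b
  | Sum.inl _ => c₀Q_pos K
  | Sum.inr i => cQ_pos K i.val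

/-- BOOKED SIZE [decided toy]: coefficient × the pushed unit defect `(¼)^(k−j_b)`. [folklore] -/
def sizeQ (K : ℕ) (b : Blk 2 ⊕ Fin K) (k : ℕ) : ℝ := coefQ K b * (1 / 4 : ℝ) ^ (k - scaleQ K b)

/-- [folklore] Booked sizes are positive. -/
theorem sizeQ_pos (K : ℕ) (b : Blk 2 ⊕ Fin K) (k : ℕ) : 0 < sizeQ K b k := mul_pos (coefQ_pos K b) (by positivity)

/-- FELT FAMILIES of a cube [decided toy]: a block feels its own family; the origin cube of scale `i+1` feels everything born `≤ i+1`. [folklore] -/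
def feltQ (K : ℕ) : Blk 2 ⊕ Fin K → Finset (Blk 2 ⊕ Fin K)
  | Sum.inl x => {Sum.inl x}
  | Sum.inr i => Finset.univ.filter fun b => scaleQ K b ≤ i.val + 1

/-- [folklore] Felt families are born no later than the cube's scale. -/
theorem feltQ_scale (K : ℕ) : ∀ q, ∀ b ∈ feltQ K q, scaleQ K b ≤ scaleQ K q
  | Sum.inl x, b, hb => by
      have h : b = Sum.inl x := Finset.mem_singleton.mp hb
      subst h; exact le_rfl
  | Sum.inr i, b, hb => (Finset.mem_filter.mp hb).2

/-- THE BOOKING at cutoff `K` [decided toy]: births = cubes = `Blk 2 ⊕ Fin K` with `scaleQ`, felt sets `feltQ`, sizes `sizeQ`. [folklore] -/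
def BQ (K : ℕ) : T4TermFormat.Booking where
  K := K
  Dom := Blk 2 ⊕ Fin K
  domScale := scaleQ K
  treeLen := fun _ => 0
  treeLen_nonneg := fun _ => le_rfl
  balSize := fun _ => 0
  Birth := Blk 2 ⊕ Fin K
  births := Finset.univ
  mem_births := fun b => Finset.mem_univ b
  birthScale := scaleQ K
  birth_le := scaleQ_le K
  loc := fun b => b
  loc_scale := fun _ => rfl
  Cube := Blk 2 ⊕ Fin K
  cubes := Finset.univ
  mem_cubes := fun q => Finset.mem_univ q
  cubeScale := scaleQ K
  cube_le := scaleQ_le K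
  feltAt := feltQ K
  felt_birth_le := feltQ_scale K
  size := sizeQ K
  size_nonneg := fun b k => (sizeQ_pos K b k).le
  pair := fun _ _ _ => 0

/-- THE TRAJECTORY [decided toy]: one generation per family, birth size `3·coef`, re-linearised size = the booked size; births only. [folklore] -/
def TQ (K : ℕ) : Trajectory (BQ K) where
  lin := fun b k' k => if k' = scaleQ K b then sizeQ K b k else 0
  lin_nonneg := fun b k' k => by split_ifs <;> [exact (sizeQ_pos K b k).le; exact le_rfl]
  gen := fun b k' => if k' = scaleQ K b then 3 * coefQ K b else 0
  gen_nonneg := fun b k' => by split_ifs <;> [exact (mul_pos (by norm_num) (coefQ_pos K b)).le; exact le_rfl]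
  size_le := fun b k hbk _ => by
    change scaleQ K b ≤ k at hbk
    show sizeQ K b k ≤ ∑ k' ∈ Icc (scaleQ K b) k, (if k' = scaleQ K b then sizeQ K b k else 0)
    rw [Finset.sum_ite_eq' (Icc (scaleQ K b) k) (scaleQ K b) (fun _ => sizeQ K b k), if_pos (Finset.mem_Icc.mpr ⟨le_rfl, hbk⟩)]

/-- THE TOWER [decided toy]. [folklore] -/
def towerQ : DressedTower Unit where
  B := fun _ K => BQ K
  K_eq := fun _ _ => rfl
  T := fun _ K => TQ K

/-- THE CARRIED FUNCTION of generation `k′` of family `b` [decided toy]: the birth generation is `U ↦ coef b · U`; none later. [folklore] -/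
def FnQ (K : ℕ) (b : Blk 2 ⊕ Fin K) (k' : ℕ) (U : ℂ) : ℂ := if k' = scaleQ K b then (coefQ K b : ℂ) * U else 0

/-- THE STEP-`0` COMPONENT ∕ LIVE SET of a family [decided toy]: a block family is alone in its own block; a chain member is not yet
born. [folklore] -/
def blockOf (K : ℕ) : Blk 2 ⊕ Fin K → Finset (Blk 2 ⊕ Fin K)
  | Sum.inl x => {Sum.inl x}
  | Sum.inr _ => ∅

/-- THE LIVE FAMILIES of a step-`k` component [decided toy]: at step `0` the block family alone; at `1 ≤ k ≤ K` everything born `≤ k`;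
none above the cutoff. [folklore] -/
def SQ (K k : ℕ) (b : Blk 2 ⊕ Fin K) : Finset (Blk 2 ⊕ Fin K) :=
  if k = 0 then blockOf K b else if k ≤ K then Finset.univ.filter (fun f => scaleQ K f ≤ k) else ∅

/-- THE COMPONENT of a step-`k` family [decided toy]: at step `0` its own block; at `1 ≤ k ≤ K` THE origin cube of scale `k`. [folklore] -/
def compQ (K k : ℕ) (b : Blk 2 ⊕ Fin K) : Finset (Blk 2 ⊕ Fin K) :=
  if h0 : k = 0 then blockOf K b else if h : k ≤ K then {Sum.inr ⟨k - 1, by omega⟩} else ∅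

/-- THE ANCHORING on `ℕ⁴` at the blocking integer `2` [decided toy]: block family `x` at `coords x`, the chain at the origin block; block
cubes centred at their block, origin cubes at `0` — `felt_under` through the GENUINE coarsening `coarsen 2 (i+1) (coords x) = 0` (W14's
`coarsen_coords_succ`). [folklore] -/
def anchQ (K : ℕ) : Anchoring (BQ K) 4 2 where
  dom := fun b => match b with | Sum.inl x => {coords x} | Sum.inr _ => {0}
  center := fun q => match q with | Sum.inl x => coords x | Sum.inr _ => 0
  felt_under := fun q b hb => by
    rcases q with x | i
    · have h : b = Sum.inl x := Finset.mem_singleton.mp hb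
      subst h
      refine ⟨coords x, mem_singleton_self _, ?_⟩
      show coarsen 2 (0 - 0) (coords x) = coords x
      exact coarsen_coords_zero x
    · rcases b with y | j
      · refine ⟨coords y, mem_singleton_self _, ?_⟩
        show coarsen 2 (i.val + 1 - 0) (coords y) = 0
        exact coarsen_coords_succ y i.val
      · exact ⟨0, mem_singleton_self _, funext fun l => by simp [coarsen]⟩

/-- THE ABSORBED FAMILIES [decided toy]: the chain head absorbs ALL SIXTEEN block families, every later member the previous one, a block
nobody. [folklore] -/
def absorbsQ (K : ℕ) : Blk 2 ⊕ Fin K → Finset (Blk 2 ⊕ Fin K)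
  | Sum.inl _ => ∅
  | Sum.inr i => if i.val = 0 then Finset.univ.map ⟨Sum.inl, Sum.inl_injective⟩
      else {Sum.inr ⟨i.val - 1, lt_of_le_of_lt (Nat.sub_le _ _) i.isLt⟩}

/-- PRE-ℝ SIZE before the ℝ-operation of scale `k` [decided toy]: the rate times the dressed envelope at `k−1` (EQUALITY seam). [folklore] -/
def preQ (K : ℕ) (b : Blk 2 ⊕ Fin K) (k : ℕ) : ℝ :=
  (((2 : ℝ) ^ 2)⁻¹ * 1) * (TQ K).envVar (4 * 1 / 1) (fun _ : ℕ => ((2 : ℝ) ^ 2)⁻¹ * 1) b (k - 1)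

/-- THE ℝ-STEP DATUM [decided toy]: `pre = preQ`, `absorbs = absorbsQ`, component = the birth cube, `δ` = W37's dressing `βR`. [folklore] -/
def RsQ (K : ℕ) : RStep (BQ K) where
  pre := preQ K
  pre_nonneg := fun b k => mul_nonneg (by norm_num) (Trajectory.envVar_nonneg (by norm_num) (fun _ => by norm_num) b (k - 1))
  absorbs := absorbsQ K
  absorbs_lt := fun b' b hb => by
    rcases b' with x | i
    · exact absurd hb (Finset.notMem_empty _)
    · change scaleQ K b < i.val + 1
      simp only [absorbsQ] at hb
      split_ifs at hb with h0
      · obtain ⟨y, -, rfl⟩ := Finset.mem_map.mp hb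
        exact Nat.succ_pos _
      · rw [Finset.mem_singleton.mp hb]
        show i.val - 1 + 1 < i.val + 1
        omega
  comp := fun b => {b}
  comp_scale := fun b q hq => by rw [Finset.mem_singleton.mp hq]; rfl
  absorbs_felt := fun b' b hb => by
    refine ⟨b', Finset.mem_singleton_self _, ?_⟩
    rcases b' with x | i
    · exact absurd hb (Finset.notMem_empty _)
    · refine Finset.mem_filter.mpr ⟨Finset.mem_univ (α := Blk 2 ⊕ Fin K) b, ?_⟩
      simp only [absorbsQ] at hb
      split_ifs at hb with h0
      · obtain ⟨y, -, rfl⟩ := Finset.mem_map.mp hb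
        exact Nat.zero_le _
      · rw [Finset.mem_singleton.mp hb]
        show i.val - 1 + 1 ≤ i.val + 1
        omega
  δ := fun b => βR K (scaleQ K b)
  δ_nonneg := fun b => by unfold βR; positivity

/-! ## §2 Row S3u §2's function-level binders on the datum (W37 §2's proofs on the new index type) -/

/-- **F-1 AT BIRTH** [decided toy]: a `BirthSlice` along the affine chart (window `1`, radius `1`, `closedBall 0 1`), SHARP sup `3·coef b`; any history. [folklore] -/
theorem hG_Q (K : ℕ) (Gate : ℕ → Prop) : ∀ (b : (BQ K).Birth) (k' : ℕ), (BQ K).birthScale b ≤ k' → k' ≤ (BQ K).K →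
    RanBelow Gate k' → BirthSlice (FnQ K b k') (fun U d t => U + t * d) (fun d : ℂ => ‖d‖) (closedBall (0 : ℂ) 1) 1 1 ((TQ K).gen b k') := by
  intro b k' _ _ _ U hU d hd hdw
  show ∃ Dm : Set ℂ, DifferentiableOn ℂ (fun t : ℂ => FnQ K b k' (U + t * d)) Dm ∧
      (∀ t ∈ Dm, ‖FnQ K b k' (U + t * d)‖ ≤ (if k' = scaleQ K b then 3 * coefQ K b else 0)) ∧
      ∀ s ∈ Set.Icc (0 : ℝ) 1, closedBall (s : ℂ) (1 / ‖d‖) ⊆ Dm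
  by_cases hk' : k' = scaleQ K b
  · refine ⟨closedBall (0 : ℂ) (1 + 1 / ‖d‖), ?_, ?_, ?_⟩
    · unfold FnQ
      simp only [if_pos hk']
      exact ((differentiable_const _).mul ((differentiable_const _).add
        (differentiable_id.mul (differentiable_const _)))).differentiableOn
    · intro t ht
      rw [if_pos hk']
      unfold FnQ
      rw [if_pos hk', norm_mul, Complex.norm_real, Real.norm_of_nonneg (coefQ_pos K b).le, mul_comm]
      refine mul_le_mul_of_nonneg_right ?_ (coefQ_pos K b).le
      have htd : ‖t‖ * ‖d‖ ≤ (1 + 1 / ‖d‖) * ‖d‖ := mul_le_mul_of_nonneg_right (mem_closedBall_zero_iff.mp ht) (norm_nonneg d)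
      rw [add_mul, one_mul, one_div, inv_mul_cancel₀ hd.ne'] at htd
      calc ‖U + t * d‖ ≤ ‖U‖ + ‖t‖ * ‖d‖ := (norm_add_le _ _).trans (by rw [norm_mul])
        _ ≤ 1 + (‖d‖ + 1) := add_le_add (mem_closedBall_zero_iff.mp hU) htd
        _ ≤ 3 := by linarith
    · intro s hs t ht
      rw [mem_closedBall, dist_eq_norm] at ht
      have h2 : ‖(s : ℂ)‖ ≤ 1 := by rw [Complex.norm_real, Real.norm_of_nonneg hs.1]; exact hs.2
      rw [mem_closedBall_zero_iff]
      calc ‖t‖ = ‖t - (s : ℂ) + (s : ℂ)‖ := by rw [sub_add_cancel]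
        _ ≤ ‖t - (s : ℂ)‖ + ‖(s : ℂ)‖ := norm_add_le _ _
        _ ≤ 1 / ‖d‖ + 1 := add_le_add ht h2
        _ = 1 + 1 / ‖d‖ := add_comm _ _
  · refine ⟨Set.univ, ?_, ?_, fun _ _ => Set.subset_univ _⟩
    · unfold FnQ
      simp only [if_neg hk']
      exact differentiableOn_const 0
    · intro t _
      unfold FnQ
      simp [hk']

/-- `hinv`: invariance under the trivial relation. [folklore] -/
theorem hinv_Q (K : ℕ) (b : (BQ K).Birth) (k' : ℕ) : GaugeInvariant (fun U U' : ℂ => U = U') (FnQ K b k') := fun _ _ h => by rw [h]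

/-- `hVK` — containment of W20's push. [folklore] -/
theorem hVK_Q (K : ℕ) : ∀ (b : (BQ K).Birth) (k' k : ℕ), (BQ K).birthScale b ≤ k' → k' ≤ k → k ≤ (BQ K).K →
    ∀ X₀ ∈ closedBall (0 : ℂ) 1, vmap k' k X₀ ∈ closedBall (0 : ℂ) 1 := by
  intro b k' k _ _ _ X₀ hX₀
  rw [mem_closedBall_zero_iff] at hX₀ ⊢
  rw [norm_vmap]
  calc (1 / 4 : ℝ) ^ (k - k') * ‖X₀‖ ≤ 1 * 1 := mul_le_mul (theta_pow_le_one _) hX₀ (norm_nonneg _) zero_le_one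
    _ = 1 := one_mul _

/-- `hVrel` — felt-size contraction PERFORMED by W20's push. [folklore] -/
theorem hVrel_Q (K : ℕ) : ∀ (b : (BQ K).Birth) (k' k : ℕ), (BQ K).birthScale b ≤ k' → k' ≤ k → k ≤ (BQ K).K →
    ∀ X₀ ∈ closedBall (0 : ℂ) 1, ∀ X₁ : ℂ, ∀ δ : ℝ,
      RelGauge (fun U U' : ℂ => U = U') (fun U d t => U + t * d) (fun d : ℂ => ‖d‖) X₀ X₁ δ →
      RelGauge (fun U U' : ℂ => U = U') (fun U d t => U + t * d) (fun d : ℂ => ‖d‖) (vmap k' k X₀) (vmap k' k X₁)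
        ((1 / 4 : ℝ) ^ (k - k') * δ) := by
  intro b k' k _ _ _ X₀ _ X₁ δ h
  obtain ⟨d, hd0, hdδ, hX₁⟩ := h
  refine ⟨vmap k' k d, ?_, ?_, ?_⟩
  · show 0 < ‖vmap k' k d‖
    rw [norm_vmap]; exact mul_pos (by positivity) hd0
  · show ‖vmap k' k d‖ ≤ (1 / 4 : ℝ) ^ (k - k') * δ
    rw [norm_vmap]; exact mul_le_mul_of_nonneg_left hdδ (by positivity)
  · show vmap k' k X₁ = vmap k' k X₀ + 1 * vmap k' k d
    rw [show X₁ = X₀ + 1 * d from hX₁, vmap_affine]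

/-- `hneX` — admissible unit pairs exist; any history. [folklore] -/
theorem hneX_Q (K : ℕ) (Gate : ℕ → Prop) : ∀ (b : (BQ K).Birth) (k' k : ℕ), (BQ K).birthScale b ≤ k' → k' ≤ k → k ≤ (BQ K).K →
    RanBelow Gate k → ∃ X₀ ∈ closedBall (0 : ℂ) 1, ∃ X₁ : ℂ,
      RelGauge (fun U U' : ℂ => U = U') (fun U d t => U + t * d) (fun d : ℂ => ‖d‖) X₀ X₁ ((fun _ : ℕ => (1 : ℝ)) k) :=
  fun _ _ _ _ _ _ _ => ⟨0, mem_closedBall_self zero_le_one, 0 + 1 * 1, 1, by simp, by simp, rfl⟩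

/-- [folklore] The composed increment over a scale-`k` unit pair: `≤ coef b · θ^(k−k′)` for the birth generation, `0` otherwise. -/
theorem composed_increment_le (K : ℕ) (b : (BQ K).Birth) (k' k : ℕ) {X₀ X₁ : ℂ}
    (h : RelGauge (fun U U' : ℂ => U = U') (fun U d t => U + t * d) (fun d : ℂ => ‖d‖) X₀ X₁ 1) :
    ‖FnQ K b k' (vmap k' k X₁) - FnQ K b k' (vmap k' k X₀)‖ ≤ if k' = scaleQ K b then coefQ K b * (1 / 4 : ℝ) ^ (k - k') else 0 := by
  obtain ⟨d, _, hd1, hX₁⟩ := h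
  have hX : X₁ = X₀ + 1 * d := hX₁
  unfold FnQ
  by_cases hk' : k' = scaleQ K b
  · rw [if_pos hk', if_pos hk', if_pos hk', ← mul_sub, hX, vmap_affine, add_sub_cancel_left, one_mul, norm_mul,
      Complex.norm_real, Real.norm_of_nonneg (coefQ_pos K b).le, norm_vmap]
    refine mul_le_mul_of_nonneg_left ?_ (coefQ_pos K b).le
    calc (1 / 4 : ℝ) ^ (k - k') * ‖d‖ ≤ (1 / 4 : ℝ) ^ (k - k') * 1 := mul_le_mul_of_nonneg_left hd1 (by positivity)
      _ = (1 / 4 : ℝ) ^ (k - k') := mul_one _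
  · rw [if_neg hk', if_neg hk', if_neg hk', sub_zero, norm_zero]

/-- [folklore] … and the UNIT pair `(0, 1)` ATTAINS it. -/
theorem composed_increment_unit (K : ℕ) (b : (BQ K).Birth) (k : ℕ) :
    ‖FnQ K b (scaleQ K b) (vmap (scaleQ K b) k (0 + 1 * 1)) - FnQ K b (scaleQ K b) (vmap (scaleQ K b) k 0)‖ = sizeQ K b k := by
  unfold FnQ sizeQ
  rw [if_pos rfl, if_pos rfl, zero_add, one_mul, ← mul_sub]
  unfold vmap
  rw [mul_zero, mul_one, sub_zero, norm_mul, Complex.norm_real, Complex.norm_real, Real.norm_of_nonneg (coefQ_pos K b).le,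
    Real.norm_of_nonneg (by positivity)]

/-- `hsupX` — the booking convention on unit pairs, ATTAINED; any history. [folklore] -/
theorem hsupX_Q (K : ℕ) (Gate : ℕ → Prop) : ∀ (b : (BQ K).Birth) (k' k : ℕ), (BQ K).birthScale b ≤ k' → k' ≤ k → k ≤ (BQ K).K →
    RanBelow Gate k → (TQ K).lin b k' k ≤ sSup {x : ℝ | ∃ X₀ ∈ closedBall (0 : ℂ) 1, ∃ X₁ : ℂ,
      RelGauge (fun U U' : ℂ => U = U') (fun U d t => U + t * d) (fun d : ℂ => ‖d‖) X₀ X₁ ((fun _ : ℕ => (1 : ℝ)) k) ∧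
        x = ‖FnQ K b k' (vmap k' k X₁) - FnQ K b k' (vmap k' k X₀)‖} := by
  intro b k' k _ _ _ _
  have hbdd : BddAbove {x : ℝ | ∃ X₀ ∈ closedBall (0 : ℂ) 1, ∃ X₁ : ℂ,
      RelGauge (fun U U' : ℂ => U = U') (fun U d t => U + t * d) (fun d : ℂ => ‖d‖) X₀ X₁ ((fun _ : ℕ => (1 : ℝ)) k) ∧
        x = ‖FnQ K b k' (vmap k' k X₁) - FnQ K b k' (vmap k' k X₀)‖} := by
    refine ⟨if k' = scaleQ K b then coefQ K b * (1 / 4 : ℝ) ^ (k - k') else 0, ?_⟩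
    rintro x ⟨X₀, -, X₁, hrel, rfl⟩
    exact composed_increment_le K b k' k hrel
  show (if k' = scaleQ K b then sizeQ K b k else 0) ≤ _
  by_cases hk' : k' = scaleQ K b
  · rw [if_pos hk']
    refine le_csSup hbdd ⟨0, mem_closedBall_self zero_le_one, 0 + 1 * 1, ⟨1, by simp, by simp, rfl⟩, ?_⟩
    rw [hk', composed_increment_unit]
  · rw [if_neg hk']
    exact Real.sSup_nonneg (by rintro x ⟨_, -, _, -, rfl⟩; exact norm_nonneg _)

/-- (w5) `hreg`: births only (idle, as W18∕W37); any history. [folklore] -/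
theorem hreg_Q (K : ℕ) (Gate : ℕ → Prop) : (TQ K).RegeneratesFromVar (fun _ : ℕ => (0 : ℝ)) Gate := by
  intro b k hbk _ _
  show (if k + 1 = scaleQ K b then 3 * coefQ K b else 0) ≤ 0 * sizeQ K b k
  have hne : k + 1 ≠ scaleQ K b := by change scaleQ K b ≤ k at hbk; omega
  rw [if_neg hne, zero_mul]

end Summit.QuantumFields.BalabanUV.T4Continuum.NE1p.DressedSuppliedBlockAbsorptionWitness

end
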